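import Summits.Ventures.PercRepro.PuncturedLYMSuperSharp

/-!
# PercRepro — (SP) BY SUPERPOSITION, PART 9: THE CHAIN CERTIFICATE — (SP) FROM AN EXPLICIT LP-DUAL CERTIFICATE
(p10, gen 31)

The profile bound of PuncturedLYMProfileSum counts the words at each distance separately.  The words at distance `a`
and those at distance `a + 1` from a `j`-set `X` COMPETE for the `(j−1)`-sets meeting `X` in `a` points: a word at
distance `a` contains `j − a` of them, a word at distance `a + 1` contains `a + 1` of them, and each such set lies in at
most one word (`card_profile_pair_le`, THE JOINT PACKING COUNT: `(j − a)·m_a + (a + 1)·m_{a+1} ≤ s_a`).  Any nonnegative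
`λ` with `e(a) ≤ (j − a)·λ_a + a·λ_{a−1}` is then a DUAL CERTIFICATE: `Σ_B e(#(X ∩ B)) ≤ Σ_{a<j} λ_a·s_a`
(`sum_eDef_le_of_cert`), and `≤ Σ_{a<j−1} λ_a·s_a` when no word is near `X` (`sum_eDef_le_of_cert_of_no_near`).
* **`puncturedNMP_of_cert`** — (SP) for every code admitting a certificate with
  `Σ_{a<j} λ_a·s_a + Σ_{a<j−1} λ_a·s_a ≤ 1` (`1 ≤ j`, `2j + 1 ≤ n`): the same corrected superposition, with the
  certificate bounds in place of the class-by-class ones.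
The greedy certificate `λ_a = max 0 ((e(a) − a·λ_{a−1})/(j − a))` realises the Steiner value of the profile sum; the
instances with `2j + 1 ≤ n ≤ 3j − 3` where it closes (all of them for `j ≤ 7`) are PuncturedLYMChainInstances.
Nothing here asserts (SP) in general.
-/

namespace PercRepro.PuncturedLYM

open Finset

variable {α : Type} [Fintype α] [DecidableEq α]

/-! ### The joint packing count -/

/-- The words of `D` at distance `a` from `X`, each with its points outside `X`, together with the words at distance
`a + 1`, each with its points inside `X`. -/
def pairs (D : Finset (Finset α)) (X : Finset α) (a : ℕ) : Finset (Σ _ : Finset α, α) :=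
  (D.filter (fun B => (X ∩ B).card = a)).sigma (fun B => B \ X) ∪
    (D.filter (fun B => (X ∩ B).card = a + 1)).sigma (fun B => B ∩ X)

omit [Fintype α] in
/-- `#pairs = (j − a)·m_a + (a + 1)·m_{a+1}` for a code and a `j`-set `X` (`a < j`). -/
theorem card_pairs {j : ℕ} {D : Finset (Finset α)} (hD : IsCode j D) (X : Finset α) {a : ℕ}
    (ha : a < j) :
    (pairs D X a).card = (D.filter (fun B => (X ∩ B).card = a)).card * (j - a) +
      (D.filter (fun B => (X ∩ B).card = a + 1)).card * (a + 1) := by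
  unfold pairs
  rw [card_union_of_disjoint]
  · congr 1
    · rw [card_sigma]
      have : ∀ B ∈ D.filter (fun B => (X ∩ B).card = a), (B \ X).card = j - a := by
        intro B hB
        rw [mem_filter] at hB
        have h1 := card_sdiff_add_card_inter B X
        rw [inter_comm, hB.2, hD.1 B hB.1] at h1
        omega
      rw [sum_congr rfl this, sum_const, smul_eq_mul]
    · rw [card_sigma]
      have : ∀ B ∈ D.filter (fun B => (X ∩ B).card = a + 1), (B ∩ X).card = a + 1 := by
        intro B hB
        rw [mem_filter] at hB
        rw [inter_comm]
        exact hB.2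
      rw [sum_congr rfl this, sum_const, smul_eq_mul]
  · rw [disjoint_left]
    rintro ⟨B, p⟩ h1 h2
    simp only [mem_sigma, mem_filter] at h1 h2
    omega

/-- **The joint packing count**: `(j − a)·m_a + (a + 1)·m_{a+1} ≤ #midSets a` — the map `(B, p) ↦ B ∖ p` is injective on
`pairs` into the `(j−1)`-sets meeting `X` in `a` points (a `(j−1)`-set lies in at most one code word). -/
theorem card_profile_pair_le {j : ℕ} {D : Finset (Finset α)} (hD : IsCode j D) {X : Finset α} (hX : X.card = j)
    {a : ℕ} (ha : a < j) :
    (D.filter (fun B => (X ∩ B).card = a)).card * (j - a) +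
      (D.filter (fun B => (X ∩ B).card = a + 1)).card * (a + 1) ≤ (midSets α j X a).card := by
  rw [← card_pairs hD X ha]
  have hinj : Set.InjOn (fun p : Σ _ : Finset α, α => p.1.erase p.2) (pairs D X a : Set _) := by
    rintro ⟨B, p⟩ hp ⟨B', p'⟩ hp' h
    simp only [mem_coe, pairs, mem_union, mem_sigma, mem_filter] at hp hp'
    have h' : B.erase p = B'.erase p' := h
    have hBD : B ∈ D := by rcases hp with ⟨⟨h, -⟩, -⟩ | ⟨⟨h, -⟩, -⟩ <;> exact h
    have hB'D : B' ∈ D := by rcases hp' with ⟨⟨h, -⟩, -⟩ | ⟨⟨h, -⟩, -⟩ <;> exact h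
    have hpB : p ∈ B := by
      rcases hp with ⟨-, h⟩ | ⟨-, h⟩
      · exact (mem_sdiff.1 h).1
      · exact (mem_inter.1 h).1
    have hp'B : p' ∈ B' := by
      rcases hp' with ⟨-, h⟩ | ⟨-, h⟩
      · exact (mem_sdiff.1 h).1
      · exact (mem_inter.1 h).1
    have hBB' : B = B' := by
      by_contra hne
      have h1 := hD.2 B hBD B' hB'D hne
      have h2 : B.erase p ⊆ B ∩ B' := by
        intro w hw
        rw [mem_inter]
        refine ⟨mem_of_mem_erase hw, ?_⟩
        rw [h'] at hw
        exact mem_of_mem_erase hw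
      have := card_le_card h2
      rw [card_erase_of_mem hpB, hD.1 B hBD] at this
      omega
    subst hBB'
    have hpp' : p = p' := erase_injOn B hpB hp'B h'
    rw [hpp']
  have hsub : (pairs D X a).image (fun p : Σ _ : Finset α, α => p.1.erase p.2) ⊆ midSets α j X a := by
    intro S hS
    rw [mem_image] at hS
    obtain ⟨⟨B, p⟩, hp, rfl⟩ := hS
    simp only [pairs, mem_union, mem_sigma, mem_filter] at hp
    rw [midSets, mem_filter, mem_powersetCard]
    rcases hp with ⟨⟨hBD, hBa⟩, hp⟩ | ⟨⟨hBD, hBa⟩, hp⟩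
    · -- distance `a`, `p ∉ X`
      have hpB : p ∈ B := (mem_sdiff.1 hp).1
      have hpX : p ∉ X := (mem_sdiff.1 hp).2
      refine ⟨⟨subset_univ _, by rw [card_erase_of_mem hpB, hD.1 B hBD]⟩, ?_⟩
      have : B.erase p ∩ X = X ∩ B := by
        ext w
        simp only [mem_inter, mem_erase]
        constructor
        · rintro ⟨⟨-, hwB⟩, hwX⟩
          exact ⟨hwX, hwB⟩
        · rintro ⟨hwX, hwB⟩
          exact ⟨⟨fun h => hpX (h ▸ hwX), hwB⟩, hwX⟩
      rw [this, hBa]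
    · -- distance `a + 1`, `p ∈ X`
      have hpB : p ∈ B := (mem_inter.1 hp).1
      have hpX : p ∈ X := (mem_inter.1 hp).2
      refine ⟨⟨subset_univ _, by rw [card_erase_of_mem hpB, hD.1 B hBD]⟩, ?_⟩
      have : B.erase p ∩ X = (X ∩ B).erase p := by
        ext w
        simp only [mem_inter, mem_erase]
        tauto
      rw [this, card_erase_of_mem (mem_inter.2 ⟨hpX, hpB⟩), hBa]
      rfl
  calc (pairs D X a).card = ((pairs D X a).image (fun p : Σ _ : Finset α, α => p.1.erase p.2)).card :=
        (card_image_of_injOn hinj).symm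
    _ ≤ (midSets α j X a).card := card_le_card hsub

/-! ### The certificate bound -/

/-- The profile of `X` in `D`: `m_a = #{B ∈ D : #(X ∩ B) = a}`. -/
def profileCount (D : Finset (Finset α)) (X : Finset α) (a : ℕ) : ℕ :=
  (D.filter (fun B => (X ∩ B).card = a)).card

/-- The mid-set count `s_a = C(j,a)·C(n−j, j−1−a)` as a rational. -/
def sQ (α : Type) [Fintype α] (j a : ℕ) : ℚ := ((j.choose a * (Fintype.card α - j).choose (j - 1 - a) : ℕ) : ℚ)

/-- The induction behind the certificate bound: `T_k + k·λ_{k−1}·m_k ≤ Σ_{a<k} λ_a s_a` for `1 ≤ k ≤ j`. -/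
theorem cert_induction {j : ℕ} {D : Finset (Finset α)} (hD : IsCode j D)
    {X : Finset α} (hX : X.card = j) (lam : ℕ → ℚ) (hlam : ∀ a, a < j → 0 ≤ lam a)
    (hcert : ∀ a, a < j → eDef α j a ≤ ((j : ℚ) - a) * lam a + (a : ℚ) * lam (a - 1)) :
    ∀ k, 1 ≤ k → k ≤ j →
      ∑ a ∈ range k, (profileCount D X a : ℚ) * eDef α j a + (k : ℚ) * lam (k - 1) * profileCount D X k ≤
        ∑ a ∈ range k, lam a * sQ α j a := by
  -- the joint packing count, in `ℚ`
  have hpack : ∀ a, a < j → ((j : ℚ) - a) * profileCount D X a + ((a : ℚ) + 1) * profileCount D X (a + 1) ≤ sQ α j a := by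
    intro a ha
    have h := card_profile_pair_le hD hX ha
    rw [card_midSets hX (by omega)] at h
    unfold profileCount sQ
    have h' : (((D.filter (fun B => (X ∩ B).card = a)).card * (j - a) +
        (D.filter (fun B => (X ∩ B).card = a + 1)).card * (a + 1) : ℕ) : ℚ) ≤
        ((j.choose a * (Fintype.card α - j).choose (j - 1 - a) : ℕ) : ℚ) := by exact_mod_cast h
    push_cast [Nat.cast_sub ha.le] at h'
    push_cast
    linarith
  intro k hk1 hkj
  induction k, hk1 using Nat.le_induction with
  | base =>
    -- `k = 1`: `m_0 e(0) + λ_0 m_1 ≤ λ_0 (j m_0 + m_1) ≤ λ_0 s_0`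
    simp only [sum_range_one, Nat.cast_one, one_mul, Nat.sub_self]
    have hc := hcert 0 (by omega)
    simp only [Nat.cast_zero, sub_zero, zero_mul, add_zero] at hc
    have hp := hpack 0 (by omega)
    simp only [Nat.cast_zero, sub_zero, zero_add, one_mul] at hp
    have h0 := hlam 0 (by omega)
    have hm0 : (0 : ℚ) ≤ profileCount D X 0 := by positivity
    nlinarith [mul_le_mul_of_nonneg_left hc hm0, mul_le_mul_of_nonneg_left hp h0]
  | succ k hk ih =>
    have ih' := ih (by omega)
    rw [sum_range_succ, sum_range_succ]
    have hc := hcert k (by omega)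
    have hp := hpack k (by omega)
    have hlk := hlam k (by omega)
    have hmk : (0 : ℚ) ≤ profileCount D X k := by positivity
    have hcast : ((k + 1 - 1 : ℕ) : ℚ) = (k : ℚ) := by simp
    rw [Nat.add_sub_cancel]
    push_cast
    nlinarith [mul_le_mul_of_nonneg_left hc hmk, mul_le_mul_of_nonneg_left hp hlk]

/-- **The certificate bound.** For a code `D`, a `j`-set `X ∉ D` and nonnegative `λ` with
`e(a) ≤ (j − a)·λ a + a·λ (a − 1)` on `a < j`: `Σ_B e(#(X ∩ B)) ≤ Σ_{a<j} λ a · s_a` (`1 ≤ j`). -/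
theorem sum_eDef_le_of_cert {j : ℕ} {D : Finset (Finset α)} (hD : IsCode j D) (hj : 1 ≤ j)
    {X : Finset α} (hX : X.card = j) (hXD : X ∉ D) (lam : ℕ → ℚ)
    (hlam : ∀ a, a < j → 0 ≤ lam a)
    (hcert : ∀ a, a < j → eDef α j a ≤ ((j : ℚ) - a) * lam a + (a : ℚ) * lam (a - 1)) :
    ∑ B ∈ D, eDef α j (X ∩ B).card ≤ ∑ a ∈ range j, lam a * sQ α j a := by
  have hmj : profileCount D X j = 0 := by
    unfold profileCount
    rw [card_eq_zero, filter_eq_empty_iff]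
    intro B hB h
    have := aOf_lt (hD.1 B hB) hX (fun h' => hXD (h' ▸ hB))
    exact absurd h (by unfold aOf at this; omega)
  have hmaps : ∀ B ∈ D, (X ∩ B).card ∈ range j := by
    intro B hB
    rw [mem_range]
    exact aOf_lt (hD.1 B hB) hX (fun h => hXD (h ▸ hB))
  rw [← sum_fiberwise_of_maps_to hmaps]
  have hfib : ∀ a ∈ range j, ∑ B ∈ D.filter (fun B => (X ∩ B).card = a), eDef α j (X ∩ B).card =
      (profileCount D X a : ℚ) * eDef α j a := by
    intro a _
    unfold profileCount
    rw [← nsmul_eq_mul, ← sum_const]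
    apply sum_congr rfl
    intro B hB
    rw [(mem_filter.1 hB).2]
  rw [sum_congr rfl hfib]
  have h := cert_induction hD hX lam hlam hcert j hj le_rfl
  rw [hmj] at h
  simp only [Nat.cast_zero, mul_zero, add_zero] at h
  exact h

/-- **The certificate bound without the top class**: if no word is near `X`, `Σ_B e(#(X ∩ B)) ≤ Σ_{a<j−1} λ a · s_a`
(`2 ≤ j`). -/
theorem sum_eDef_le_of_cert_of_no_near {j : ℕ} {D : Finset (Finset α)} (hD : IsCode j D) (hj : 2 ≤ j)
    {X : Finset α} (hX : X.card = j) (hXD : X ∉ D)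
    (hnear : ∀ B ∈ D, (X ∩ B).card + 1 ≠ j) (lam : ℕ → ℚ) (hlam : ∀ a, a < j → 0 ≤ lam a)
    (hcert : ∀ a, a < j → eDef α j a ≤ ((j : ℚ) - a) * lam a + (a : ℚ) * lam (a - 1)) :
    ∑ B ∈ D, eDef α j (X ∩ B).card ≤ ∑ a ∈ range (j - 1), lam a * sQ α j a := by
  have hmtop : profileCount D X (j - 1) = 0 := by
    unfold profileCount
    rw [card_eq_zero, filter_eq_empty_iff]
    intro B hB h
    exact hnear B hB (by omega)
  have hmaps : ∀ B ∈ D, (X ∩ B).card ∈ range j := by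
    intro B hB
    rw [mem_range]
    exact aOf_lt (hD.1 B hB) hX (fun h => hXD (h ▸ hB))
  rw [← sum_fiberwise_of_maps_to hmaps]
  have hfib : ∀ a ∈ range j, ∑ B ∈ D.filter (fun B => (X ∩ B).card = a), eDef α j (X ∩ B).card =
      (profileCount D X a : ℚ) * eDef α j a := by
    intro a _
    unfold profileCount
    rw [← nsmul_eq_mul, ← sum_const]
    apply sum_congr rfl
    intro B hB
    rw [(mem_filter.1 hB).2]
  rw [sum_congr rfl hfib]
  have h := cert_induction hD hX lam hlam hcert (j - 1) (by omega) (by omega)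
  rw [hmtop] at h
  simp only [Nat.cast_zero, mul_zero, add_zero] at h
  -- the top term of the left sum vanishes as well
  have : ∑ a ∈ range j, (profileCount D X a : ℚ) * eDef α j a =
      ∑ a ∈ range (j - 1), (profileCount D X a : ℚ) * eDef α j a := by
    rw [← Nat.sub_add_cancel (by omega : 1 ≤ j), sum_range_succ, Nat.sub_add_cancel (by omega : 1 ≤ j), hmtop]
    simp
  rw [this]
  exact h

/-! ### (SP) from a certificate -/

/-- **(SP) from a certificate**: if `λ ≥ 0` certifies the profile bound and
`Σ_{a<j} λ_a s_a + Σ_{a<j−1} λ_a s_a ≤ 1`, the code satisfies (SP) (`2 ≤ j`, `2j + 1 ≤ n`). -/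
theorem puncturedNMP_of_cert {j : ℕ} {D : Finset (Finset α)} (hD : IsCode j D) (hj : 2 ≤ j)
    (hn : 2 * j + 1 ≤ Fintype.card α) (lam : ℕ → ℚ) (hlam : ∀ a, a < j → 0 ≤ lam a)
    (hcert : ∀ a, a < j → eDef α j a ≤ ((j : ℚ) - a) * lam a + (a : ℚ) * lam (a - 1))
    (hbound : ∑ a ∈ range j, lam a * sQ α j a + ∑ a ∈ range (j - 1), lam a * sQ α j a ≤ 1) :
    PuncturedNMP j D := by
  have hjn : j < Fintype.card α := by omega
  have hj0 : 0 < j := by omega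
  have hj1 : 1 ≤ j := by omega
  have hn2 : 2 * j ≤ Fintype.card α := by omega
  have hnj : (0 : ℚ) < (Fintype.card α : ℚ) - j := by
    have : (j : ℚ) < Fintype.card α := by exact_mod_cast hjn
    linarith
  set NX : ℚ := ∑ a ∈ range j, lam a * sQ α j a with hNX
  set NB : ℚ := ∑ a ∈ range (j - 1), lam a * sQ α j a with hNB
  have hNB0 : 0 ≤ NB := sum_nonneg (fun a ha => mul_nonneg (hlam a (by have := mem_range.1 ha; omega)) (by unfold sQ; positivity))
  set M : ℚ := NB / ((Fintype.card α : ℚ) - j) with hM_def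
  have hM0 : 0 ≤ M := div_nonneg hNB0 hnj.le
  have hM : ∀ B ∈ D, ∀ y' ∉ B, max (errE α j D B y') 0 ≤ M := by
    intro B hB y' _
    calc max (errE α j D B y') 0
        ≤ (∑ B' ∈ D.erase B, eDef α j (B ∩ B').card) / ((Fintype.card α : ℚ) - j) := max_errE_le hD hn2 hjn hB y'
      _ ≤ M := by
          rw [hM_def]
          apply div_le_div_of_nonneg_right _ hnj.le
          apply sum_eDef_le_of_cert_of_no_near (isCode_erase hD B) hj (hD.1 B hB) (notMem_erase B D) _ lam hlam hcert
          intro B' hB'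
          have hne : B ≠ B' := (ne_of_mem_erase hB').symm
          have := hD.2 B hB B' (mem_of_mem_erase hB') hne
          omega
  set c : ℚ := ((punctured j D).card : ℚ) / (levelAbove α j).card with hc_def
  have hc0 : 0 ≤ c := by positivity
  refine puncturedNMP_of_weights (fun X Y => totalWp α j D X Y / c) ?_ ?_ ?_
  · intro X hX Y hY
    obtain ⟨hXc, hXD⟩ := mem_punctured.1 hX
    rw [sups_eq hXc] at hY
    obtain ⟨y, hy, rfl⟩ := mem_image.1 hY
    rw [totalWp_insert j D X (mem_sdiff.1 hy).2]
    apply div_nonneg _ hc0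
    have h1 := superW_ge hD hn2 hjn X y
    have h2 := sum_reroute_ge hD hjn hM0 hM hXc (mem_sdiff.1 hy).2
    have hN := sum_eDef_le_of_cert hD hj1 hXc hXD lam hlam hcert
    unfold totalW
    have hkey : 0 ≤ (1 - ∑ B ∈ D, eDef α j (X ∩ B).card) / ((Fintype.card α : ℚ) - j) - M := by
      rw [hM_def, ← sub_div]
      apply div_nonneg _ hnj.le
      linarith
    linarith
  · intro X hX
    rw [← sum_div, sum_sups_totalWp hD hjn hX, hc_def, one_div_div]
  · intro Y hY
    rw [← sum_div, sum_subsP_totalWp hD hj0 hjn (mem_levelAbove.1 hY), ← hc_def]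
    rcases eq_or_ne c 0 with hc | hc
    · rw [hc, div_zero]
      exact zero_le_one
    · rw [div_self hc]

end PercRepro.PuncturedLYM
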